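import Literature.AlgebraicGeometry.Modules.ModuleCechPrune
import Literature.AlgebraicGeometry.Modules.CechProductCoverColumnCollapse
import HarnessLib

/-!
# The module Čech complex of `G` on the opens `O ∩ W_j` IS the Čech complex of `G|_O = ι_O^* G` on `ι_O⁻¹ W_j` («open-piece bridge»)

Layer `Literature/AlgebraicGeometry/Modules`, namespace `Literature.AlgebraicGeometry.Modules`.  THEOREMS ONLY (no definition, no instance,
no notation, no named fact, no `sorry`).  Cell `hodgecm-mathlib` (D-0151), P6 «MOD programme», DUAL-S road (A) «CBC cut», hand (CBC-4a) cut
out of the CBC-4 head «PIC⁰-ONTO, ANY CHARACTERISTIC» by B-p08 (g34) (2026-09-02).  USE: a column of the product-cover bicomplex (★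
`Modules/CechProductCoverColumnCollapse`) over an affine piece `U_σ` of the base is the CBC-1 complex of the restricted morphism
`p₁|_{U_σ} : p₁⁻¹U_σ → U_σ` with the cover `(p₁⁻¹U_σ).ι⁻¹(p₂⁻¹V_j)` and the module `ι^*K`.  HC_CM is proved only modulo the printed citations until
rung 0 closes; nothing here is about HC.

THE MATHEMATICS ([GortzWedhorn2023] Def. 21.68 (the ordered Čech complex of a family of opens with values in an `𝒪`-module); [Hartshorne1977]
II §5 p. 110 and III Lemma 4.1 ∕ Prop. 8.1 proof (restriction of a module to an open and its Čech complex); [StacksProject] Tag 01FG).  Let `O ⊆ Z`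
be an open subscheme with its open immersion `ι = O.ι : O → Z`, `G` an `𝒪_Z`-module, `𝓦 = (W_j)_{j ∈ κ}` a linearly ordered family of opens of
`Z`, `ρ : A → Γ(Z, 𝒪_Z)` a ring of scalars.  For every open `V ⊆ O` one has `Γ(ι^*G, V) = Γ(G|_O, V) = Γ(G, ι(V))` (Mathlib's `restrictFunctor`,
which has this as a DEFINITIONAL equality, and `restrictFunctorIsoPullback : restrictFunctor ι ≅ pullback ι`), the `A`-module structures through
`ρ` and `ι^♯ ∘ ρ` agree (§2: `(ι.appIso V)⁻¹ (ρ(a)|_V) = ρ(a)|_{ι(V)}`), and for a NON-EMPTY finite `t ⊆ κ`,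
`ι(⋂_{j∈t} ι⁻¹W_j) = O ∩ ⋂_{j∈t} W_j = ⋂_{j∈t} (O ∩ W_j)` (§1).  These identifications commute with the restriction maps, so they assemble
(★ `OrderedCech.sysComplexIsoNE`, which only reads non-empty simplices) to an isomorphism of cochain complexes of `A`-modules
`Č((O ∩ W_j)_j, G; ρ) ≅ Č((ι⁻¹W_j)_j, G|_O; ι^♯∘ρ) ≅ Č((ι⁻¹W_j)_j, ι^*G; ι^♯∘ρ)` (§3; the second step is ★ `sectionsSystemIsoOfIso` along
`restrictFunctorIsoPullback`).  In particular the two complexes are exact in the same degrees, for ANY rings of scalars on either side (★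
`exactAt_cechComplex_iff_of_scalars`) (§4).

MAIN STATEMENTS.  §3 **`nonempty_cechComplex_inf_iso_cechComplex_preimage_ι`** — VERBATIM the (CBC-4a) letter:
`Nonempty (cechComplex (fun j => O ⊓ 𝓦 j) G ρ ≅ cechComplex (fun j => O.ι ⁻¹ᵁ 𝓦 j) ((Scheme.Modules.pullback O.ι).obj G) (O.ι.appTop.hom.comp ρ))`;
§4 **`exactAt_cechComplex_preimage_ι_iff`** `(ρ″ : A″ →+* Γ(↑O, ⊤)) (n : ℤ) :
(cechComplex (fun j => O.ι ⁻¹ᵁ 𝓦 j) ((Scheme.Modules.pullback O.ι).obj G) ρ″).ExactAt n ↔ (cechComplex (fun j => O ⊓ 𝓦 j) G ρ).ExactAt n`.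

## References
* [GortzWedhorn2023] U. Görtz, T. Wedhorn, *Algebraic Geometry II: Cohomology of Schemes* (2023), Def. 21.64, Def. 21.68 (pp. 179–180).
* [Hartshorne1977] R. Hartshorne, *Algebraic Geometry* (1977), II §5 (p. 110); III Lemma 4.1 (p. 218), proof of Prop. 8.1 (p. 250).
* [StacksProject] The Stacks Project, Tag 01FG (Čech complex and restriction), Tag 02N6.
-/

set_option backward.isDefEq.respectTransparency false -- `Scheme.Modules` is not reducible (as in ★ `CechProductCoverColumnCollapse`)
set_option autoImplicit false

noncomputable section

universe u

open CategoryTheory CategoryTheory.Limits AlgebraicGeometry TopologicalSpace HomologicalComplex Opposite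
open Literature.Algebra.Homology Literature.Algebra.Homology.OrderedCech

namespace Literature.AlgebraicGeometry.Modules

variable {Z : Scheme.{u}} (O : Z.Opens) {κ : Type} [LinearOrder κ] (𝓦 : κ → Z.Opens) (G : Z.Modules)
  {A : Type u} [CommRing A] (ρ : A →+* Γ(Z, ⊤))

/-! ## §1 The opens: `ι(ι⁻¹W) = O ∩ W` and `ι(⋂ ι⁻¹W_j) = ⋂ (O ∩ W_j)` on non-empty simplices -/

/-- `O.ι ''ᵁ (O.ι ⁻¹ᵁ W) = O ⊓ W` (Mathlib `image_preimage_eq_opensRange_inf`, `opensRange_ι`). [cite: Hartshorne1977, II Ex. 2.2 (p. 79)] -/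
theorem image_ι_preimage_ι (W : Z.Opens) : O.ι ''ᵁ (O.ι ⁻¹ᵁ W) = O ⊓ W := by
  rw [Scheme.Hom.image_preimage_eq_opensRange_inf, Scheme.Opens.opensRange_ι]

omit [LinearOrder κ] in
/-- On a NON-EMPTY simplex `t`: `O.ι ''ᵁ ⋂_{j ∈ t} O.ι⁻¹W_j = ⋂_{j ∈ t} (O ⊓ W_j)` (for `t = ∅` the left side is `O`, the right side `Z`).
[cite: GortzWedhorn2023, Def. 21.64 (p. 179)] -/
theorem image_ι_cechOpen_preimage_ι (t : Finset κ) (ht : t.Nonempty) :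
    O.ι ''ᵁ cechOpen (fun j => O.ι ⁻¹ᵁ 𝓦 j) t = cechOpen (fun j => O ⊓ 𝓦 j) t := by
  rw [← preimage_cechOpen, image_ι_preimage_ι, cechOpen_inf_left _ _ _ ht]

/-! ## §2 The scalars: `ρ` through `ι^♯` on `Γ(O, V)` is `ρ` on `Γ(Z, ι(V))` -/

/-- **The two `A`-module structures agree**: under Mathlib's ring identification `(O.ι.appIso V)⁻¹ : Γ(O, V) ≅ Γ(Z, O.ι ''ᵁ V)` the scalar
`ρ(a)|_V` computed on `O` through `ι^♯ ∘ ρ` goes to the scalar `ρ(a)|_{ι(V)}` computed on `Z` (★ `toSections`; Mathlib `appLE_appIso_inv`).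
[cite: Hartshorne1977, II §5 (p. 110)] [cite: StacksProject, Tag 02N6] -/
theorem appIso_inv_toSections (V : O.toScheme.Opens) (a : A) :
    (O.ι.appIso V).inv (toSections (O.ι.appTop.hom.comp ρ) V a) = toSections ρ (O.ι ''ᵁ V) a := by
  change (O.ι.appLE ⊤ V le_top ≫ (O.ι.appIso V).inv) (ρ a) = _
  rw [Scheme.Hom.appLE_appIso_inv]
  rfl

/-- **`Γ(G|_O, V) = Γ(G, ι(V))` as `A`-modules, read on an open `U = ι(V)` of `Z`**: there is an `A`-linear isomorphism
`SecMod G ρ U ≃ₗ[A] SecMod (G.restrict O.ι) (ι^♯ ∘ ρ) V` which on underlying sections is the restriction of `G` along `ι(V) ≤ U` (an equality)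
— Mathlib's definitional `Γ(G.restrict O.ι, V) = Γ(G, O.ι ''ᵁ V)` (`restrict_obj`) with the scalars matched by `appIso_inv_toSections`.
[cite: Hartshorne1977, II §5 (p. 110)] [cite: GortzWedhorn2023, Def. 21.68 (p. 180)] -/
theorem exists_linearEquiv_secMod_restrict (U : Z.Opens) (V : O.toScheme.Opens) (hUV : O.ι ''ᵁ V = U) :
    ∃ e : SecMod G ρ U ≃ₗ[A] SecMod (G.restrict O.ι) (O.ι.appTop.hom.comp ρ) V,
      ∀ x, SecMod.val (e x) = (show Γ(G.restrict O.ι, V) from G.presheaf.map (homOfLE hUV.le).op (SecMod.val x)) := by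
  -- forward: restrict along `ι(V) ≤ U`; backward: along `U ≤ ι(V)`
  let fwd : SecMod G ρ U →ₗ[A] SecMod (G.restrict O.ι) (O.ι.appTop.hom.comp ρ) V :=
    { toFun := fun x => SecMod.mk (ρ := O.ι.appTop.hom.comp ρ)
        (show Γ(G.restrict O.ι, V) from (G.presheaf.map (homOfLE hUV.le).op (SecMod.val x) : Γ(G, O.ι ''ᵁ V)))
      map_add' := fun x y => by
        apply SecMod.val_injective
        change G.presheaf.map (homOfLE hUV.le).op (SecMod.val x + SecMod.val y) = _
        rw [map_add]
        rfl
      map_smul' := fun a x => by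
        apply SecMod.val_injective
        change G.presheaf.map (homOfLE hUV.le).op (toSections ρ U a • SecMod.val x) =
          (O.ι.appIso V).inv (toSections (O.ι.appTop.hom.comp ρ) V a) • G.presheaf.map (homOfLE hUV.le).op (SecMod.val x)
        rw [Scheme.Modules.map_smul, resO_toSections, appIso_inv_toSections] }
  let bwd : SecMod (G.restrict O.ι) (O.ι.appTop.hom.comp ρ) V →ₗ[A] SecMod G ρ U :=
    { toFun := fun y => SecMod.mk (ρ := ρ) (G.presheaf.map (homOfLE hUV.ge).op
        (show Γ(G, O.ι ''ᵁ V) from SecMod.val (L := G.restrict O.ι) (ρ := O.ι.appTop.hom.comp ρ) y))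
      map_add' := fun x y => by
        apply SecMod.val_injective
        change G.presheaf.map (homOfLE hUV.ge).op
            ((show Γ(G, O.ι ''ᵁ V) from SecMod.val (L := G.restrict O.ι) (ρ := O.ι.appTop.hom.comp ρ) x) +
              (show Γ(G, O.ι ''ᵁ V) from SecMod.val (L := G.restrict O.ι) (ρ := O.ι.appTop.hom.comp ρ) y)) = _
        rw [map_add]
        rfl
      map_smul' := fun a y => by
        apply SecMod.val_injective
        change G.presheaf.map (homOfLE hUV.ge).op
            ((O.ι.appIso V).inv (toSections (O.ι.appTop.hom.comp ρ) V a) •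
              (show Γ(G, O.ι ''ᵁ V) from SecMod.val (L := G.restrict O.ι) (ρ := O.ι.appTop.hom.comp ρ) y)) =
          toSections ρ U a • G.presheaf.map (homOfLE hUV.ge).op
            (show Γ(G, O.ι ''ᵁ V) from SecMod.val (L := G.restrict O.ι) (ρ := O.ι.appTop.hom.comp ρ) y)
        rw [Scheme.Modules.map_smul, appIso_inv_toSections, resO_toSections] }
  have hfb : ∀ y, fwd (bwd y) = y := fun y => by
    apply SecMod.val_injective
    change (G.presheaf.map (homOfLE hUV.ge).op ≫ G.presheaf.map (homOfLE hUV.le).op)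
        (show Γ(G, O.ι ''ᵁ V) from SecMod.val (L := G.restrict O.ι) (ρ := O.ι.appTop.hom.comp ρ) y) =
      (show Γ(G, O.ι ''ᵁ V) from SecMod.val (L := G.restrict O.ι) (ρ := O.ι.appTop.hom.comp ρ) y)
    rw [← Functor.map_comp, ← op_comp, show homOfLE hUV.le ≫ homOfLE hUV.ge = 𝟙 _ from Subsingleton.elim _ _, op_id,
      G.presheaf.map_id]
    rfl
  have hbf : ∀ x, bwd (fwd x) = x := fun x => by
    apply SecMod.val_injective
    change (G.presheaf.map (homOfLE hUV.le).op ≫ G.presheaf.map (homOfLE hUV.ge).op) (SecMod.val x) = SecMod.val x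
    rw [← Functor.map_comp, ← op_comp, show homOfLE hUV.ge ≫ homOfLE hUV.le = 𝟙 _ from Subsingleton.elim _ _, op_id,
      G.presheaf.map_id]
    rfl
  exact ⟨LinearEquiv.ofLinear fwd bwd (LinearMap.ext hfb) (LinearMap.ext hbf), fun x => rfl⟩

/-! ## §3 The isomorphism of Čech complexes -/

/-- **`Č((O ∩ W_j)_j, G; ρ) ≅ Č((ι⁻¹W_j)_j, G|_O; ι^♯∘ρ)`** for Mathlib's restriction `G|_O = G.restrict O.ι` (termwise §2 on the non-empty simplices,
natural under restriction since both sides restrict sections of `G`; ★ `OrderedCech.sysComplexIsoNE`). [cite: GortzWedhorn2023, Def. 21.68 (p. 180)]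
[cite: Hartshorne1977, III Lemma 4.1 (p. 218)] -/
theorem nonempty_cechComplex_inf_iso_cechComplex_preimage_ι_restrict :
    Nonempty (cechComplex (fun j => O ⊓ 𝓦 j) G ρ ≅
      cechComplex (fun j => O.ι ⁻¹ᵁ 𝓦 j) (G.restrict O.ι) (O.ι.appTop.hom.comp ρ)) := by
  choose e he using fun t : {t : Finset κ // t.Nonempty} =>
    exists_linearEquiv_secMod_restrict O G ρ (cechOpen (fun j => O ⊓ 𝓦 j) t.1) (cechOpen (fun j => O.ι ⁻¹ᵁ 𝓦 j) t.1)
      (image_ι_cechOpen_preimage_ι O 𝓦 t.1 t.2)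
  refine ⟨sysComplexIsoNE (M := sectionsSystem (fun j => O ⊓ 𝓦 j) G ρ)
    (M' := sectionsSystem (fun j => O.ι ⁻¹ᵁ 𝓦 j) (G.restrict O.ι) (O.ι.appTop.hom.comp ρ))
    (fun t ht => e ⟨t, ht⟩) fun s t hs ht h x => ?_⟩
  apply SecMod.val_injective (L := G.restrict O.ι) (ρ := O.ι.appTop.hom.comp ρ)
  change SecMod.val (L := G.restrict O.ι) (ρ := O.ι.appTop.hom.comp ρ) (e ⟨t, ht⟩ (SecMod.res G ρ (cechOpen_anti _ h) x)) =
    (G.restrict O.ι).presheaf.map (homOfLE (cechOpen_anti (fun j => O.ι ⁻¹ᵁ 𝓦 j) h)).op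
      (SecMod.val (L := G.restrict O.ι) (ρ := O.ι.appTop.hom.comp ρ) (e ⟨s, hs⟩ x))
  rw [he, he, Scheme.Modules.restrict_map, SecMod.val_res]
  change (G.presheaf.map _ ≫ G.presheaf.map _) (SecMod.val (L := G) (ρ := ρ) x) =
    (G.presheaf.map _ ≫ G.presheaf.map _) (SecMod.val (L := G) (ρ := ρ) x)
  rw [← Functor.map_comp, ← Functor.map_comp]
  rfl

/-- **THE OPEN-PIECE BRIDGE `Č((O ∩ W_j)_j, G; ρ) ≅ Č((ι⁻¹W_j)_j, ι^*G; ι^♯∘ρ)`** — VERBATIM the (CBC-4a) letter of B-p08 (g34): the previous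
isomorphism followed by ★ `sectionsSystemIsoOfIso` along Mathlib's `restrictFunctorIsoPullback O.ι : restrictFunctor ≅ pullback` at `G`.
[cite: GortzWedhorn2023, Def. 21.68 (p. 180)] [cite: Hartshorne1977, III Lemma 4.1 (p. 218) and proof of Prop. 8.1 (p. 250)] [cite: StacksProject, Tag 01FG] -/
theorem nonempty_cechComplex_inf_iso_cechComplex_preimage_ι :
    Nonempty (cechComplex (fun j => O ⊓ 𝓦 j) G ρ ≅
      cechComplex (fun j => O.ι ⁻¹ᵁ 𝓦 j) ((Scheme.Modules.pullback O.ι).obj G) (O.ι.appTop.hom.comp ρ)) := by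
  obtain ⟨e⟩ := nonempty_cechComplex_inf_iso_cechComplex_preimage_ι_restrict O 𝓦 G ρ
  exact ⟨e ≪≫ sectionsSystemIsoOfIso (fun j => O.ι ⁻¹ᵁ 𝓦 j) ((Scheme.Modules.restrictFunctorIsoPullback O.ι).app G)
    (O.ι.appTop.hom.comp ρ)⟩

/-! ## §4 Exactness transfers, with free scalars on the open piece -/

/-- **Exactness of `Č((ι⁻¹W_j)_j, ι^*G)` in degree `n` ⇔ exactness of `Č((O ∩ W_j)_j, G)` in degree `n`**, for ANY ring of scalars `ρ″` on the open
piece (★ `exactAt_cechComplex_iff_of_scalars`: exactness does not see the scalars) — the form the CBC-4 assembly consumes column by column.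
[cite: GortzWedhorn2023, Def. 21.68 (p. 180)] [cite: StacksProject, Tag 01FG] -/
theorem exactAt_cechComplex_preimage_ι_iff {A'' : Type u} [CommRing A''] (ρ'' : A'' →+* Γ(O.toScheme, ⊤)) (n : ℤ) :
    (cechComplex (fun j => O.ι ⁻¹ᵁ 𝓦 j) ((Scheme.Modules.pullback O.ι).obj G) ρ'').ExactAt n ↔
      (cechComplex (fun j => O ⊓ 𝓦 j) G ρ).ExactAt n := by
  obtain ⟨e⟩ := nonempty_cechComplex_inf_iso_cechComplex_preimage_ι O 𝓦 G ρ
  rw [exactAt_cechComplex_iff_of_scalars (fun j => O.ι ⁻¹ᵁ 𝓦 j) ((Scheme.Modules.pullback O.ι).obj G) ρ''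
    (O.ι.appTop.hom.comp ρ) n]
  exact (exactAt_iff_of_quasiIsoAt e.hom n).symm

end Literature.AlgebraicGeometry.Modules

end
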